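import Literature.MathematicalPhysics.QuantumFieldTheory.Balaban1983to89.B9Thm39CinvAtCoverLargeDefect
import Literature.MathematicalPhysics.QuantumFieldTheory.Balaban1983to89.B9Thm39CinvAtCoverMember

/-!
# `Balaban1983to89.B9Thm39CinvAtCoverMemberDefect` — [Balaban1985BackgroundPropagators] THEOREM 3.9 pp. 411–413 ⇒ THEOREM 3.2 (3.48) p. 398 FOR
# `C(U) = (Q′G′²Q′*)⁻¹(U)` AT GENERIC LETTERS `(parS, G′, U)`, AT THE CUBE COVER OF RECORD, LOCAL-INVERSE LAW OF THE CUBE LETTERS UP TO A DISPLAYED DEFECT: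
# FILE 14 (`B9Thm39CinvAtCoverMember`) re-run on E1-2/E1-4 (cell `lit-balaban`, G-B9-LETTERS module M5.2-E ∕ M5.6, file E1-5, seat p21 gen 34; design memo
# `lit-balaban-p21/M52E-DESIGN-p21.md` v1) — the shape the junction J-B 20 ∕ M5.9 A7 compose at `parKnitY`

statement-level skeleton of published theorems with citation tags; proofs where landed; nothing here is a claim about the Yang–Mills mass gap

CITATION HEADER (lean-in-tree rule).  B9 = T. Bałaban, *Propagators for lattice gauge theories in a background field*, Commun. Math. Phys. **99** (1985)
389–434 (journal page = PDF page + 388).  p. 408 (the partition `{h_□}`, `□̃ⁿ`); p. 409 l. 2–5 («the operators constructed for this sequence … C_□(U) =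
(Q′(U)G′²_□(U)Q′*(U))⁻¹»), (3.87); p. 411 (3.95)/(3.96); p. 412 (3.97); p. 413 Theorem 3.9 («For M sufficiently large … This theorem implies Theorem 3.2»);
(3.21)/(3.25) pp. 394–395; Thm 3.2 (3.48) p. 398; p. 398 (scale transfer).  [4] = [Balaban1984PropagatorsII] (2.36) p. 229, Lemma 2.1 (2.59)–(2.63), (2.66)
pp. 233–234, (2.83)–(2.87) pp. 237–238.  Rows B9.Thm3.9 × B9.Thm3.2 × B9.Eq3.95 × B9.Eq3.87 (cells only; no row head changes).

WHY THIS FILE (M5.2-E, memo §3 E1-5).  FILE 14 re-ran FILES 10/12/13 one level lower, at GENERIC letters `(parS, G′, U)` with SITE-majorant inputs `hGG`/`hGGc`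
(the shape p33's junction J-B 20 `hasMajorant_conj_XinvY_parKnitY_of_site` and t2s-1's A7 compose at `parKnitY`).  With the local-inverse law of the cube letters
holding only up to the displayed defect `E_□` (an (R)-DESIGN TERM, NOT IN PRINT — READING NOTE G-B9-p21-01: print's `C_□` is [4] (2.79)–(2.82)'s compression inverse of
`□̃Q′G′(□̃)²Q′*□̃` with the GLOBAL averaging `Q′` (p. 411 «in the same way as in (2.82) [4]»; map owner r06 first-hand on CMP 96 p. 237), for which (3.95) is an
EXACT identity; the tree's cube letter of record `B9CubeLettersBondOpsL0.CCubeY` (lead RULING #5: the SEQUENCE-averaged full inverse on the cube sequence's own blocks,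
chosen to avoid inverse-of-compression decay at a general field) satisfies the law only up to the defect `Σ_□ h_□□̃Q′G′²_□(Q′* − Q′*_□)C_□h_□`, of size `e^{−O(δ₀M)}`
= the order of print's own (3.97) factors, p. 412 l. 31–35; nothing fails as printed), THIS FILE is FILE 14 verbatim on E1-2's `hasMajorant_conj_XinvY_final_loc_defect` and E1-4's four-term
arithmetic: `hloc ↦ hdef + hEd`, `θ₄ = 3·5^{d+1}κ_Ee^{−a_Xδ₀D_sep}`, smallness terms each `≦ 1/(8c₁)`.

WHAT IS PROVED (all `theorem`s, 0 `def`, 0 sorry, 0 new named facts).  ★★ `final_cover_defect` (cover of record), ★★ `final_cover_above_defect` (geometry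
discharged), ★★★ `final_cover_large_defect` (located smallness discharged: `∃ M_L K, ∀ member above M_L, ∀ letters`).

HONEST SCOPE / NOT CLAIMED.  Exactly FILE 14's scope with the weakened law (the fourth sum is the (R)-design term above, not a term of print): DISPLAYED per member/letter remain the site majorants `hGG`/`hGGc` (M5.5 FILE 7 from
`EBlock`s; at `parKnitY` the junction's shapes), the cube letters `Cl` with `hdef`/`hEd`/`hC` (M5.2-E supply), the LOCALIZED [2]-difference `hD` (GAPS G-B9-05 —
NOT derived in the tree), `IsUnit XY`, `hpar`, `hrepr`; rate data, splits, nonneg constants.  Sup-entry (3.48) only.  Finite 𝕋 member of the k-level V1 family;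
constants explicit; nothing continuum, nothing about the mass gap; NOT summit progress.  RELATED, NOT DUPLICATED (searched 2026-08-28: `lean search
'final_cover_defect|final_cover_large_defect' --decl` = ∅): FILE 14 (exact law; kept for J-B 20 ∕ A7), E1-1…E1-4.
-/

noncomputable section

namespace Literature.MathematicalPhysics.QuantumFieldTheory.Balaban1983to89.B9Thm39CinvAtCoverMemberDefect

open Node00
open B6Geom246MultiLevelBox (blkOf)
open B6Cover236MultiLevelBlocks (cubes)
open B6Cover236MultiLevelTorusBlocks (hB cubeIndT)
open B6Partition118KLevelTorusBinders (sLipT)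
open B6Ineq2142KLevelV1 (β)
open B6KLevelCensusIndexV1 (KIdx)
open B6RandomWalk (HasMajorant Ineq261 Ineq263 hasMajorant_mono)
open B9Thm34Ext (toB6)
open B9GeoNormsKLevelV1 (geo9K)
open B9GeoLemma21KLevelV1 (one_le_Mh)
open B9RWSums347DefiniteFaces (exp261)
open B9Eq352DivFormLetters (conj)
open B9Thm37CubeCoverCommutators (cutMulY)
open B9Thm37CubeCoverCommutatorSizes (four_le_P')
open B9Thm37GpTorusRegularCubes (SQT hcnt_SQT)
open B9Ineq349SiteComposite (etaS_pos)
open B9Thm39CinvFinalLocDefect (hasMajorant_conj_XinvY_final_loc_defect)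
open B9Thm39CinvAtCover (SQbigT chiBigT DsepT lipT indicator_SQbigT_eq indicator_SQT_eq sum_hB_sq_blk abs_hB_le hS_cover hsep_cover hLip_cover
  geo9K_basic lipT_nonneg chiBigT_01 chiBigT_eq_one chiBigT_supp)
open B9GeoInputsMultiRateKLevelV1 (geo_inputs3_geo9K scaleTransfer_len_inv4_geo9K)
open B9Thm39CinvAtCoverAbove (size_of_threshold)
open B9Thm39CinvAtCoverLarge (DsepT_eq_div lipT_eq)
open B9Thm39CinvAtCoverLargeDefect (smallness_shape4)

variable {d ℓ : ℕ} {hd : 1 ≤ d + 1} {hL : Odd (ℓ + 1) ∧ 1 < ℓ + 1} {b₀ b₁ : ℝ}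
variable {𝔸 : Type} [NormedRing 𝔸] [NormedAlgebra ℂ 𝔸] [CompleteSpace 𝔸]
variable {ι : Type} [Fintype ι] [DecidableEq ι]

/-! ## §1 ★★ E1-2's member-level assembly at the cube cover of record (FILE 14 §1 twin) -/

section Cover

variable (i : KIdx d ℓ hd hL b₀ b₁) (b : Module.Basis ι ℝ 𝔸)
variable [Fintype (geo9K i).Site] [DecidableEq (geo9K i).Site] {Rr : ℝ} {Hp : Prop}
variable (parS : SiteParY 𝔸 i) (Gp : SiteOpY 𝔸 i) (U : CfgY 𝔸 i) (ιB : BlkY i → IBondY i)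

/-- ★★ **THEOREM 3.9 ⇒ THEOREM 3.2 (3.48) FOR `C(U) = (Q′G′²Q′*)⁻¹(U)` AT GENERIC LETTERS, AT THE CUBE COVER OF RECORD** (E1-2 `hasMajorant_conj_XinvY_final_loc_defect` with
`h_□ := hB i.D □` — «Σ h²_□ = 1», read on 𝔅 —, `χ_□ := 1_{□̃}`, `S_□ := □⁺`, `S^χ_□ := □̃`, `N := 3·5^{d+1}`, `D_sep := M/(2L²)`, `ℓ₀ := 0`, `ℓ₁ := 2s_T/M`, `s := (η²η²)⁻¹`,
`s′ := η²η²`, `P := ℓ⁻⁴` and the four distance facts of `geo9K` discharged): from `IsUnit (XY i parS G′ U)`, contractive transporters, the coordinate bound `M₂` of `b`,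
the SITE majorants `conj b ((η²η²)•(G′·G′)) ≺ κ_G·ℓ(a)⁴·e^{−a_Lδ₀d}` of `G′ = Gp` and of every cube letter `G′_□ = Oc □`, the per-cube local-inverse law UP TO THE DISPLAYED DEFECT (`hdef`, `hEd`; E1-1's fourth sum, `θ₄ = 3·5^{d+1}κ_Ee^{−a_Xδ₀D_sep}`) and
un-localized (3.48) blocks `hC` of the `C_□ = Cl □`, the LOCALIZED [2]-difference majorants `hD` of `conj b ((η²η²)•(M_{1_{□̃}}(XY G′ − XY G′_□)M_{1_{□⁺}}))` (GAP G-B9-05),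
the scale transfer of `ℓ⁻⁴` at `α_st`, (2.61) at `(δ₀, b−ρ)`, (2.61)/(2.63) at `(ρδ₀, α′)`, the exponent splits and the located smallness ⟹
`conj b ((η²η²)⁻¹•(XinvY i parS G′ U)) ≺ 3·5^{d+1}·B₀·c₁(ρδ₀,α′)(1 − (θ₁+θ₂+θ₃+θ₄)c₁(ρδ₀,α′))⁻¹·ℓ(a)⁻⁴·e^{−(1−α′)ρδ₀d(a,a′)}` on the block carrier `(t, j) ↦ ιB t`.
[cite: Balaban1985BackgroundPropagators, Thm 3.9 p.413 + (3.95)–(3.97) pp.411–412 + (3.87) p.409 + p.408 + Thm 3.2 (3.48) p.398;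
Balaban1984PropagatorsII, (2.36) p.229 + Lemma 2.1 p.234 + (2.83)–(2.85) pp.237–238] -/
theorem final_cover_defect (Oc : ↥(cubes i.D.toDomains) → SiteOpY 𝔸 i) (hι : ∀ s, β i.hN i.D i.hk (ιB s) = s)
    (hunit : IsUnit (XY i parS Gp U))
    (hpar : ∀ z w : SiteY i, ‖(parS U z w : 𝔸)‖ ≤ 1 ∧ ‖(((parS U z w)⁻¹ : 𝔸ˣ) : 𝔸)‖ ≤ 1)
    {M₂ : ℝ} (hM₂ : 0 ≤ M₂) (hrepr : ∀ (v : 𝔸) (j : ι), |b.repr v j| ≤ M₂ * ‖v‖) (d' : ℕ)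
    {δ₀ aL aD aE aX αc αst asep ρ bb κG κD κE B₀ C α' θ₁ θ₂ θ₃ θ₄ : ℝ}
    (Cl E : ↥(cubes i.D.toDomains) → Module.End ℝ (BlkY i → 𝔸))
    (hκG : 0 ≤ κG) (hκD : 0 ≤ κD) (hκE : 0 ≤ κE) (hB₀ : 0 ≤ B₀) (hC0 : 0 ≤ C)
    (hδ₀ : 0 ≤ δ₀) (hasep : 0 ≤ asep) (hρ : 0 ≤ ρ) (hρb : ρ ≤ bb) (hρE : ρ ≤ aE) (hαc : 0 < αc * δ₀) (hα'1 : α' ≤ 1)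
    (hsplit₁ : αst + asep + ρ ≤ aL) (hsplit₂ : αst + ρ ≤ aD) (hsplit₃ : αst + αc + ρ ≤ aL)
    (hθ₁ : θ₁ = (3 * 5 ^ (d + 1)) * (((M₂ * ∑ j, ‖b j‖) ^ 2 * κG) * B₀ * C * B6.c1 d' δ₀ (bb - ρ) * Real.exp (-(asep * δ₀ * DsepT i))))
    (hθ₂ : θ₂ = (3 * 5 ^ (d + 1)) * (κD * Real.exp (-(2 * δ₀ * DsepT i)) * B₀ * C * B6.c1 d' δ₀ (bb - ρ)))
    (hθ₃ : θ₃ = (3 * 5 ^ (d + 1)) * ((lipT i * (αc * δ₀)⁻¹) * ((M₂ * ∑ j, ‖b j‖) ^ 2 * κG) * B₀ * C * B6.c1 d' δ₀ (bb - ρ)))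
    (hθ₄ : θ₄ = (3 * 5 ^ (d + 1)) * (κE * Real.exp (-(aX * δ₀ * DsepT i))))
    (hST : B9Ineq347.ScaleTransfer (geo9K i) δ₀ αst C (fun a => ((geo9K i).len a ^ 4)⁻¹)) (h261b : Ineq261 d' (toB6 (geo9K i) Rr Hp) δ₀ (bb - ρ))
    (h261 : Ineq261 d' (toB6 (geo9K i) Rr Hp) (ρ * δ₀) α') (h263 : Ineq263 d' (toB6 (geo9K i) Rr Hp) (ρ * δ₀) α')
    (hsmall : (θ₁ + θ₂ + θ₃ + θ₄) * B6.c1 d' (ρ * δ₀) α' < 1)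
    (hdef : ∀ c, (cutMulY (𝔸 := 𝔸) (hB i.D c)).restrictScalars ℝ *
      ((cutMulY (𝔸 := 𝔸) (chiBigT i c)).restrictScalars ℝ * (XY i parS (Oc c) U).restrictScalars ℝ) * Cl c *
        (cutMulY (𝔸 := 𝔸) (hB i.D c)).restrictScalars ℝ =
      (cutMulY (𝔸 := 𝔸) (hB i.D c)).restrictScalars ℝ * (cutMulY (𝔸 := 𝔸) (hB i.D c)).restrictScalars ℝ + E c)
    (hC : ∀ c, HasMajorant (g := toB6 (geo9K i) Rr Hp) (fun p : BlkY i × ι => ιB p.1) (conj b ((etaS i ^ 2 * etaS i ^ 2)⁻¹ • Cl c))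
      (fun a a' => B₀ * ((geo9K i).len a ^ 4)⁻¹ * Real.exp (-(bb * δ₀ * (geo9K i).dist a a'))))
    (hGG : HasMajorant (g := toB6 (geo9K i) Rr Hp) (fun p : SiteY i × ι => ιB (blkOf i.D.toDomains p.1))
      (conj b ((etaS i ^ 2 * etaS i ^ 2) • ((Gp U).restrictScalars ℝ * (Gp U).restrictScalars ℝ)))
      (fun a a'' => κG * (geo9K i).len a ^ 4 * Real.exp (-(aL * δ₀ * (geo9K i).dist a a''))))
    (hGGc : ∀ c, HasMajorant (g := toB6 (geo9K i) Rr Hp) (fun p : SiteY i × ι => ιB (blkOf i.D.toDomains p.1))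
      (conj b ((etaS i ^ 2 * etaS i ^ 2) • ((Oc c U).restrictScalars ℝ * (Oc c U).restrictScalars ℝ)))
      (fun a a'' => κG * (geo9K i).len a ^ 4 * Real.exp (-(aL * δ₀ * (geo9K i).dist a a''))))
    (hD : ∀ c, HasMajorant (g := toB6 (geo9K i) Rr Hp) (fun p : BlkY i × ι => ιB p.1)
      (conj b ((etaS i ^ 2 * etaS i ^ 2) • ((cutMulY (𝔸 := 𝔸) (chiBigT i c)).restrictScalars ℝ *
        ((XY i parS Gp U).restrictScalars ℝ - (XY i parS (Oc c) U).restrictScalars ℝ) *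
        (cutMulY (𝔸 := 𝔸) (cubeIndT i.D (one_le_Mh i) (four_le_P' i) c)).restrictScalars ℝ)))
      (fun a a'' => κD * Real.exp (-(2 * δ₀ * DsepT i)) * (geo9K i).len a ^ 4 * Real.exp (-(aD * δ₀ * (geo9K i).dist a a''))))
    (hEd : ∀ c, HasMajorant (g := toB6 (geo9K i) Rr Hp) (fun p : BlkY i × ι => ιB p.1) (conj b (E c))
      (fun a a' => κE * Real.exp (-(aX * δ₀ * DsepT i)) * Real.exp (-(aE * δ₀ * (geo9K i).dist a a')))) :
    HasMajorant (g := toB6 (geo9K i) Rr Hp) (fun p : BlkY i × ι => ιB p.1)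
      (conj b ((etaS i ^ 2 * etaS i ^ 2)⁻¹ • (XinvY i parS Gp U).restrictScalars ℝ))
      (fun a a' => (3 * 5 ^ (d + 1)) * B₀ * B6.c1 d' (ρ * δ₀) α' * (1 - (θ₁ + θ₂ + θ₃ + θ₄) * B6.c1 d' (ρ * δ₀) α')⁻¹ * ((geo9K i).len a ^ 4)⁻¹ *
        Real.exp (-((1 - α') * (ρ * δ₀) * (geo9K i).dist a a'))) := by
  obtain ⟨htri, hrefl, hsymm, hdnn⟩ := geo9K_basic i (Rr := Rr) (Hp := Hp)
  have hη : etaS i ^ 2 * etaS i ^ 2 ≠ 0 := ne_of_gt (mul_pos (pow_pos (etaS_pos i) 2) (pow_pos (etaS_pos i) 2))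
  have hP : ∀ a : (geo9K i).Site, 0 < ((geo9K i).len a ^ 4)⁻¹ := fun a => inv_pos.mpr (pow_pos (B6KLevelCensusIndexV1.len_pos i a) 4)
  -- the site majorants at the weight `(P a)⁻¹ = ((ℓ⁴)⁻¹)⁻¹`
  have hGG' : HasMajorant (g := toB6 (geo9K i) Rr Hp) (fun p : SiteY i × ι => ιB (blkOf i.D.toDomains p.1))
      (conj b ((etaS i ^ 2 * etaS i ^ 2) • ((Gp U).restrictScalars ℝ * (Gp U).restrictScalars ℝ)))
      (fun a a'' => κG * (((geo9K i).len a ^ 4)⁻¹)⁻¹ * Real.exp (-(aL * δ₀ * (geo9K i).dist a a''))) :=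
    hasMajorant_mono (g := toB6 (geo9K i) Rr Hp) _ hGG fun a a'' => le_of_eq (by rw [inv_inv])
  have hGGc' : ∀ c, HasMajorant (g := toB6 (geo9K i) Rr Hp) (fun p : SiteY i × ι => ιB (blkOf i.D.toDomains p.1))
      (conj b ((etaS i ^ 2 * etaS i ^ 2) • ((Oc c U).restrictScalars ℝ * (Oc c U).restrictScalars ℝ)))
      (fun a a'' => κG * (((geo9K i).len a ^ 4)⁻¹)⁻¹ * Real.exp (-(aL * δ₀ * (geo9K i).dist a a''))) := fun c =>
    hasMajorant_mono (g := toB6 (geo9K i) Rr Hp) _ (hGGc c) fun a a'' => le_of_eq (by rw [inv_inv])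
  -- the localized [2]-difference at FILE 9b's indicator cut-offs `1_{S^χ_□}∘ιB = 1_{□̃}`, `1_{S_□}∘ιB = 1_{□⁺}` and the weight `(P a)⁻¹`
  have hD' : ∀ c, HasMajorant (g := toB6 (geo9K i) Rr Hp) (fun p : BlkY i × ι => ιB p.1)
      (conj b ((etaS i ^ 2 * etaS i ^ 2) • ((cutMulY (𝔸 := 𝔸) (fun t : BlkY i => if ιB t ∈ SQbigT i c then (1 : ℝ) else 0)).restrictScalars ℝ *
        ((XY i parS Gp U).restrictScalars ℝ - (XY i parS (Oc c) U).restrictScalars ℝ) *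
        (cutMulY (𝔸 := 𝔸) (fun t : BlkY i => if ιB t ∈ SQT i c then (1 : ℝ) else 0)).restrictScalars ℝ)))
      (fun a a'' => κD * Real.exp (-(2 * δ₀ * DsepT i)) * (((geo9K i).len a ^ 4)⁻¹)⁻¹ * Real.exp (-(aD * δ₀ * (geo9K i).dist a a''))) := fun c => by
    rw [indicator_SQbigT_eq i ιB hι c, indicator_SQT_eq i ιB hι c]
    exact hasMajorant_mono (g := toB6 (geo9K i) Rr Hp) _ (hD c) fun a a'' => le_of_eq (by rw [inv_inv])
  exact hasMajorant_conj_XinvY_final_loc_defect i b ιB parS Gp U hunit hpar hM₂ hrepr d' (fun a => ((geo9K i).len a ^ 4)⁻¹)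
    (fun c => SQbigT i c) (fun c => SQT i c) (fun c => chiBigT i c) (fun c => hB i.D c) Oc Cl E (mul_inv_cancel₀ hη) hκG hκD hκE le_rfl (lipT_nonneg i) hB₀
    hC0 (by positivity) hP hδ₀ hasep hρ hρb hρE hαc hα'1 hsplit₁ hsplit₂ hsplit₃ hθ₁ hθ₂ (by rw [zero_add]; exact hθ₃) hθ₄ htri hrefl hsymm hdnn hST h261b
    h261 h263 hsmall (sum_hB_sq_blk i) (abs_hB_le i) (hS_cover i ιB hι) (hcnt_SQT i) (chiBigT_01 i) (chiBigT_eq_one i ιB hι) (chiBigT_supp i ιB hι)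
    (hsep_cover i) (hLip_cover i ιB hι) hdef hC hGG' hGGc' hD' hEd

end Cover

/-! ## §2 ★★ Above one threshold: the geometry discharged (FILE 11; FILE 14 §2 twin) -/

/-- ★★ **§1 FOR EVERY MEMBER ABOVE ONE THRESHOLD, THE GEOMETRY DISCHARGED** («For M sufficiently large»): for rate data `δ₀ > 0`, `0 < ρ < b`, `0 < α′ ≦ 1`, `α_st > 0`
there are a threshold `M_L` and an exponent `d′` such that for every member `i` with `M_L ≦ M_i` §1 holds with [4] Lemma 2.1 at `(δ₀, b−ρ)`, (2.61)/(2.63) at `(ρδ₀, α′)`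
and the scale transfer of `ℓ⁻⁴` (constant `L⁴`) discharged: from `IsUnit XY`, contractive transporters, the coordinate bound, the site majorants `hGG`/`hGGc`, the
per-cube `hdef`/`hEd`/`hC`/localized `hD` at the cover of record, the rate bookkeeping and the located smallness,
`conj b ((η²η²)⁻¹•XinvY i parS G′ U) ≺ 3·5^{d+1}B₀c₁(d′,ρδ₀,α′)(1 − (θ₁+θ₂+θ₃+θ₄)c₁(d′,ρδ₀,α′))⁻¹·ℓ(a)⁻⁴·e^{−(1−α′)ρδ₀d(a,a′)}`.
[cite: Balaban1985BackgroundPropagators, Thm 3.9 p.413 + Thm 3.2 (3.48) p.398 + p.398 (scale transfer) + (3.95)–(3.97) pp.411–412 + p.408;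
Balaban1984PropagatorsII, Lemma 2.1 (2.59)–(2.61), (2.63) pp.233–234 + (2.83)–(2.85) pp.237–238] -/
theorem final_cover_above_defect [∀ i' : KIdx d ℓ hd hL b₀ b₁, Fintype (geo9K i').Site] [∀ i' : KIdx d ℓ hd hL b₀ b₁, DecidableEq (geo9K i').Site]
    (Rr : KIdx d ℓ hd hL b₀ b₁ → ℝ) (Hp : KIdx d ℓ hd hL b₀ b₁ → Prop) (b : Module.Basis ι ℝ 𝔸)
    {M₂ : ℝ} (hM₂ : 0 ≤ M₂) (hrepr : ∀ (v : 𝔸) (j : ι), |b.repr v j| ≤ M₂ * ‖v‖)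
    {δ₀ αst bb ρ α' : ℝ} (hδ₀ : 0 < δ₀) (hρ : 0 < ρ) (hρb : ρ < bb) (hα'0 : 0 < α') (hα'1 : α' ≤ 1) (hαst : 0 < αst) :
    ∃ (ML : ℝ) (d' : ℕ), ∀ i : KIdx d ℓ hd hL b₀ b₁, ML ≤ (geo9K i).M →
      ∀ (parS : SiteParY 𝔸 i) (Gp : SiteOpY 𝔸 i) (U : CfgY 𝔸 i) (ιB : BlkY i → IBondY i) (Oc : ↥(cubes i.D.toDomains) → SiteOpY 𝔸 i)
        (hι : ∀ s, β i.hN i.D i.hk (ιB s) = s) (hunit : IsUnit (XY i parS Gp U))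
        (hpar : ∀ z w : SiteY i, ‖(parS U z w : 𝔸)‖ ≤ 1 ∧ ‖(((parS U z w)⁻¹ : 𝔸ˣ) : 𝔸)‖ ≤ 1)
        (Cl E : ↥(cubes i.D.toDomains) → Module.End ℝ (BlkY i → 𝔸))
        {aL aD aE aX αc asep κG κD κE B₀ θ₁ θ₂ θ₃ θ₄ : ℝ}
        (hκG : 0 ≤ κG) (hκD : 0 ≤ κD) (hκE : 0 ≤ κE) (hB₀ : 0 ≤ B₀) (hasep : 0 ≤ asep) (hρE : ρ ≤ aE) (hαc : 0 < αc * δ₀)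
        (hsplit₁ : αst + asep + ρ ≤ aL) (hsplit₂ : αst + ρ ≤ aD) (hsplit₃ : αst + αc + ρ ≤ aL)
        (hθ₁ : θ₁ = (3 * 5 ^ (d + 1)) * (((M₂ * ∑ j, ‖b j‖) ^ 2 * κG) * B₀ * ((ℓ : ℝ) + 1) ^ 4 * B6.c1 d' δ₀ (bb - ρ) *
          Real.exp (-(asep * δ₀ * DsepT i))))
        (hθ₂ : θ₂ = (3 * 5 ^ (d + 1)) * (κD * Real.exp (-(2 * δ₀ * DsepT i)) * B₀ * ((ℓ : ℝ) + 1) ^ 4 * B6.c1 d' δ₀ (bb - ρ)))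
        (hθ₃ : θ₃ = (3 * 5 ^ (d + 1)) * ((lipT i * (αc * δ₀)⁻¹) * ((M₂ * ∑ j, ‖b j‖) ^ 2 * κG) * B₀ * ((ℓ : ℝ) + 1) ^ 4 * B6.c1 d' δ₀ (bb - ρ)))
        (hθ₄ : θ₄ = (3 * 5 ^ (d + 1)) * (κE * Real.exp (-(aX * δ₀ * DsepT i))))
        (hsmall : (θ₁ + θ₂ + θ₃ + θ₄) * B6.c1 d' (ρ * δ₀) α' < 1)
        (hdef : ∀ c, (cutMulY (𝔸 := 𝔸) (hB i.D c)).restrictScalars ℝ *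
          ((cutMulY (𝔸 := 𝔸) (chiBigT i c)).restrictScalars ℝ * (XY i parS (Oc c) U).restrictScalars ℝ) * Cl c *
            (cutMulY (𝔸 := 𝔸) (hB i.D c)).restrictScalars ℝ =
          (cutMulY (𝔸 := 𝔸) (hB i.D c)).restrictScalars ℝ * (cutMulY (𝔸 := 𝔸) (hB i.D c)).restrictScalars ℝ + E c)
        (hC : ∀ c, HasMajorant (g := toB6 (geo9K i) (Rr i) (Hp i)) (fun p : BlkY i × ι => ιB p.1) (conj b ((etaS i ^ 2 * etaS i ^ 2)⁻¹ • Cl c))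
          (fun a a' => B₀ * ((geo9K i).len a ^ 4)⁻¹ * Real.exp (-(bb * δ₀ * (geo9K i).dist a a'))))
        (hGG : HasMajorant (g := toB6 (geo9K i) (Rr i) (Hp i)) (fun p : SiteY i × ι => ιB (blkOf i.D.toDomains p.1))
          (conj b ((etaS i ^ 2 * etaS i ^ 2) • ((Gp U).restrictScalars ℝ * (Gp U).restrictScalars ℝ)))
          (fun a a'' => κG * (geo9K i).len a ^ 4 * Real.exp (-(aL * δ₀ * (geo9K i).dist a a''))))
        (hGGc : ∀ c, HasMajorant (g := toB6 (geo9K i) (Rr i) (Hp i)) (fun p : SiteY i × ι => ιB (blkOf i.D.toDomains p.1))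
          (conj b ((etaS i ^ 2 * etaS i ^ 2) • ((Oc c U).restrictScalars ℝ * (Oc c U).restrictScalars ℝ)))
          (fun a a'' => κG * (geo9K i).len a ^ 4 * Real.exp (-(aL * δ₀ * (geo9K i).dist a a''))))
        (hD : ∀ c, HasMajorant (g := toB6 (geo9K i) (Rr i) (Hp i)) (fun p : BlkY i × ι => ιB p.1)
          (conj b ((etaS i ^ 2 * etaS i ^ 2) • ((cutMulY (𝔸 := 𝔸) (chiBigT i c)).restrictScalars ℝ *
            ((XY i parS Gp U).restrictScalars ℝ - (XY i parS (Oc c) U).restrictScalars ℝ) *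
            (cutMulY (𝔸 := 𝔸) (cubeIndT i.D (one_le_Mh i) (four_le_P' i) c)).restrictScalars ℝ)))
          (fun a a'' => κD * Real.exp (-(2 * δ₀ * DsepT i)) * (geo9K i).len a ^ 4 * Real.exp (-(aD * δ₀ * (geo9K i).dist a a''))))
        (hEd : ∀ c, HasMajorant (g := toB6 (geo9K i) (Rr i) (Hp i)) (fun p : BlkY i × ι => ιB p.1) (conj b (E c))
          (fun a a' => κE * Real.exp (-(aX * δ₀ * DsepT i)) * Real.exp (-(aE * δ₀ * (geo9K i).dist a a')))),
        HasMajorant (g := toB6 (geo9K i) (Rr i) (Hp i)) (fun p : BlkY i × ι => ιB p.1)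
          (conj b ((etaS i ^ 2 * etaS i ^ 2)⁻¹ • (XinvY i parS Gp U).restrictScalars ℝ))
          (fun a a' => (3 * 5 ^ (d + 1)) * B₀ * B6.c1 d' (ρ * δ₀) α' * (1 - (θ₁ + θ₂ + θ₃ + θ₄) * B6.c1 d' (ρ * δ₀) α')⁻¹ * ((geo9K i).len a ^ 4)⁻¹ *
            Real.exp (-((1 - α') * (ρ * δ₀) * (geo9K i).dist a a'))) := by
  -- [4] Lemma 2.1 at the two rate pairs (FILE 11 with its first pair := the second), both at the common exponent
  have h₂ : 0 < (bb - ρ) * δ₀ := mul_pos (sub_pos.mpr hρb) hδ₀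
  have h₃ : 0 < α' * (ρ * δ₀) := mul_pos hα'0 (mul_pos hρ hδ₀)
  obtain ⟨ML₀, hgeo⟩ := geo_inputs3_geo9K Rr Hp h₂ h₂ h₃ (mul_pos hρ hδ₀).le hα'1
  have hst : 0 < αst * δ₀ := mul_pos hαst hδ₀
  refine ⟨max ML₀ (4 * Real.log ((ℓ : ℝ) + 1) / (αst * δ₀)),
    max (exp261 (geo9K (d := d) (ℓ := ℓ) (hd := hd) (hL := hL) (b₀ := b₀) (b₁ := b₁)) δ₀ (bb - ρ))
      (exp261 (geo9K (d := d) (ℓ := ℓ) (hd := hd) (hL := hL) (b₀ := b₀) (b₁ := b₁)) (ρ * δ₀) α'), fun i hM => ?_⟩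
  intro parS Gp U ιB Oc hι hunit hpar Cl E aL aD aE aX αc asep κG κD κE B₀ θ₁ θ₂ θ₃ θ₄ hκG hκD hκE hB₀ hasep hρE hαc hsplit₁ hsplit₂ hsplit₃ hθ₁ hθ₂ hθ₃ hθ₄
    hsmall hdef hC hGG hGGc hD hEd
  obtain ⟨-, -, -, -, -, h261b, h261, h263⟩ := hgeo i ((le_max_left _ _).trans hM)
  -- the p. 398 scale transfer of `ℓ⁻⁴` from the explicit size condition folded into the threshold
  have hlog : 0 ≤ Real.log ((ℓ : ℝ) + 1) := Real.log_nonneg (by linarith [(Nat.cast_nonneg ℓ : (0 : ℝ) ≤ ℓ)])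
  have hMst : 4 * Real.log ((ℓ : ℝ) + 1) ≤ αst * δ₀ * (2 * ((ℓ : ℝ) + 1) ^ 2 - 1) * (geo9K i).M :=
    size_of_threshold hst (by positivity) ((le_max_right _ _).trans hM)
  have hST := scaleTransfer_len_inv4_geo9K i hst hMst
  exact final_cover_defect i b parS Gp U ιB (Rr := Rr i) (Hp := Hp i) Oc hι hunit hpar hM₂ hrepr _ Cl E hκG hκD hκE hB₀ (by positivity) hδ₀.le hasep hρ.le
    hρb.le hρE hαc hα'1 hsplit₁ hsplit₂ hsplit₃ hθ₁ hθ₂ hθ₃ hθ₄ hST h261b h261 h263 hsmall hdef hC hGG hGGc hD hEd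

/-! ## §3 ★★★ «For M sufficiently large» in full: the located smallness discharged (E1-4's four-term arithmetic; FILE 14 §3 twin) -/

/-- ★★★ **THEOREM 3.9 ⇒ THEOREM 3.2 (3.48) FOR `C(U) = (Q′G′²Q′*)⁻¹(U)` AT GENERIC LETTERS, AT THE CUBE COVER OF RECORD, FOR EVERY MEMBER ABOVE ONE THRESHOLD, WITH A
MEMBER-INDEPENDENT CONSTANT AND NO LOCATED SMALLNESS** («For M sufficiently large … the operator R is small … This theorem implies Theorem 3.2»): for the rate data of §2
and constants `κ_G, B₀, κ_D ≧ 0`, `a_sep > 0`, `α_cδ₀ > 0` and the splits, there are `M_L` and `K ≧ 0` (`K = 2·3·5^{d+1}·B₀·c₁(d′, ρδ₀, α′)` at the door exponent) such that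
for every member `i` with `M_L ≦ M_i` and every letter datum `(parS, G′, U)`, section `ιB`, cube letters `G′_□ = Oc □`, `C_□ = Cl □`: from `IsUnit (XY i parS G′ U)`,
contractive transporters, the site majorants `conj b ((η²η²)•(G′·G′)) ≺ κ_G·ℓ(a)⁴·e^{−a_Lδ₀d}` (and for each `G′_□`), the per-cube local-inverse law up to the defect `E_□` (majorant `κ_E e^{−a_Xδ₀D_sep}e^{−a_Eδ₀d}`),
un-localized (3.48) blocks of the `C_□` and localized [2]-difference majorants at the cover of record (FOUR smallness terms, each `≦ 1/(8c₁)`),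
`conj b ((η²η²)⁻¹•(XinvY i parS G′ U)) ≺ K·ℓ(a)⁻⁴·e^{−(1−α′)ρδ₀d(a,a′)}` on the block carrier `(t, j) ↦ ιB t`.
[cite: Balaban1985BackgroundPropagators, Thm 3.9 p.413 + (3.95)–(3.97) pp.411–412 + Thm 3.2 (3.48) p.398; Balaban1984PropagatorsII, (2.85)–(2.87) p.238 + Lemma 2.1 (2.66) p.234] -/
theorem final_cover_large_defect [∀ i' : KIdx d ℓ hd hL b₀ b₁, Fintype (geo9K i').Site] [∀ i' : KIdx d ℓ hd hL b₀ b₁, DecidableEq (geo9K i').Site]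
    (Rr : KIdx d ℓ hd hL b₀ b₁ → ℝ) (Hp : KIdx d ℓ hd hL b₀ b₁ → Prop) (b : Module.Basis ι ℝ 𝔸)
    {M₂ : ℝ} (hM₂ : 0 ≤ M₂) (hrepr : ∀ (v : 𝔸) (j : ι), |b.repr v j| ≤ M₂ * ‖v‖)
    {δ₀ αst bb ρ α' aL aD aE aX αc asep κG B₀ κD κE : ℝ}
    (hδ₀ : 0 < δ₀) (hρ : 0 < ρ) (hρb : ρ < bb) (hα'0 : 0 < α') (hα'1 : α' ≤ 1) (hαst : 0 < αst)
    (hasep : 0 < asep) (hαc : 0 < αc * δ₀)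
    (hsplit₁ : αst + asep + ρ ≤ aL) (hsplit₂ : αst + ρ ≤ aD) (hsplit₃ : αst + αc + ρ ≤ aL) (hρE : ρ ≤ aE) (haX : 0 < aX)
    (hκG : 0 ≤ κG) (hB₀ : 0 ≤ B₀) (hκD : 0 ≤ κD) (hκE : 0 ≤ κE) :
    ∃ ML K : ℝ, 0 ≤ K ∧ ∀ i : KIdx d ℓ hd hL b₀ b₁, ML ≤ (geo9K i).M →
      ∀ (parS : SiteParY 𝔸 i) (Gp : SiteOpY 𝔸 i) (U : CfgY 𝔸 i) (ιB : BlkY i → IBondY i) (Oc : ↥(cubes i.D.toDomains) → SiteOpY 𝔸 i)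
        (hι : ∀ s, β i.hN i.D i.hk (ιB s) = s) (hunit : IsUnit (XY i parS Gp U))
        (hpar : ∀ z w : SiteY i, ‖(parS U z w : 𝔸)‖ ≤ 1 ∧ ‖(((parS U z w)⁻¹ : 𝔸ˣ) : 𝔸)‖ ≤ 1)
        (Cl E : ↥(cubes i.D.toDomains) → Module.End ℝ (BlkY i → 𝔸))
        (hdef : ∀ c, (cutMulY (𝔸 := 𝔸) (hB i.D c)).restrictScalars ℝ *
          ((cutMulY (𝔸 := 𝔸) (chiBigT i c)).restrictScalars ℝ * (XY i parS (Oc c) U).restrictScalars ℝ) * Cl c *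
            (cutMulY (𝔸 := 𝔸) (hB i.D c)).restrictScalars ℝ =
          (cutMulY (𝔸 := 𝔸) (hB i.D c)).restrictScalars ℝ * (cutMulY (𝔸 := 𝔸) (hB i.D c)).restrictScalars ℝ + E c)
        (hC : ∀ c, HasMajorant (g := toB6 (geo9K i) (Rr i) (Hp i)) (fun p : BlkY i × ι => ιB p.1) (conj b ((etaS i ^ 2 * etaS i ^ 2)⁻¹ • Cl c))
          (fun a a' => B₀ * ((geo9K i).len a ^ 4)⁻¹ * Real.exp (-(bb * δ₀ * (geo9K i).dist a a'))))
        (hGG : HasMajorant (g := toB6 (geo9K i) (Rr i) (Hp i)) (fun p : SiteY i × ι => ιB (blkOf i.D.toDomains p.1))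
          (conj b ((etaS i ^ 2 * etaS i ^ 2) • ((Gp U).restrictScalars ℝ * (Gp U).restrictScalars ℝ)))
          (fun a a'' => κG * (geo9K i).len a ^ 4 * Real.exp (-(aL * δ₀ * (geo9K i).dist a a''))))
        (hGGc : ∀ c, HasMajorant (g := toB6 (geo9K i) (Rr i) (Hp i)) (fun p : SiteY i × ι => ιB (blkOf i.D.toDomains p.1))
          (conj b ((etaS i ^ 2 * etaS i ^ 2) • ((Oc c U).restrictScalars ℝ * (Oc c U).restrictScalars ℝ)))
          (fun a a'' => κG * (geo9K i).len a ^ 4 * Real.exp (-(aL * δ₀ * (geo9K i).dist a a''))))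
        (hD : ∀ c, HasMajorant (g := toB6 (geo9K i) (Rr i) (Hp i)) (fun p : BlkY i × ι => ιB p.1)
          (conj b ((etaS i ^ 2 * etaS i ^ 2) • ((cutMulY (𝔸 := 𝔸) (chiBigT i c)).restrictScalars ℝ *
            ((XY i parS Gp U).restrictScalars ℝ - (XY i parS (Oc c) U).restrictScalars ℝ) *
            (cutMulY (𝔸 := 𝔸) (cubeIndT i.D (one_le_Mh i) (four_le_P' i) c)).restrictScalars ℝ)))
          (fun a a'' => κD * Real.exp (-(2 * δ₀ * DsepT i)) * (geo9K i).len a ^ 4 * Real.exp (-(aD * δ₀ * (geo9K i).dist a a''))))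
        (hEd : ∀ c, HasMajorant (g := toB6 (geo9K i) (Rr i) (Hp i)) (fun p : BlkY i × ι => ιB p.1) (conj b (E c))
          (fun a a' => κE * Real.exp (-(aX * δ₀ * DsepT i)) * Real.exp (-(aE * δ₀ * (geo9K i).dist a a')))),
        HasMajorant (g := toB6 (geo9K i) (Rr i) (Hp i)) (fun p : BlkY i × ι => ιB p.1)
          (conj b ((etaS i ^ 2 * etaS i ^ 2)⁻¹ • (XinvY i parS Gp U).restrictScalars ℝ))
          (fun a a' => K * ((geo9K i).len a ^ 4)⁻¹ * Real.exp (-((1 - α') * (ρ * δ₀) * (geo9K i).dist a a'))) := by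
  obtain ⟨ML, d', h12⟩ := final_cover_above_defect (𝔸 := 𝔸) Rr Hp b hM₂ hrepr hδ₀ hρ hρb hα'0 hα'1 hαst
  -- the constants of the three sums (door exponent fixed)
  have hc0 : 0 ≤ B6.c1 d' (ρ * δ₀) α' := B6RandomWalk.c1_nonneg _ _ _
  have hcb0 : 0 ≤ B6.c1 d' δ₀ (bb - ρ) := B6RandomWalk.c1_nonneg _ _ _
  have hP0 : 0 ≤ (M₂ * ∑ j, ‖b j‖) ^ 2 * κG := mul_nonneg (sq_nonneg _) hκG
  have hL40 : 0 ≤ ((ℓ : ℝ) + 1) ^ 4 := pow_nonneg (by positivity) 4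
  have hN0 : (0 : ℝ) ≤ 3 * 5 ^ (d + 1) := by positivity
  obtain ⟨K₁, hK₁⟩ : ∃ K₁ : ℝ, K₁ = (3 * 5 ^ (d + 1)) * (((M₂ * ∑ j, ‖b j‖) ^ 2 * κG) * B₀ * ((ℓ : ℝ) + 1) ^ 4 * B6.c1 d' δ₀ (bb - ρ)) := ⟨_, rfl⟩
  obtain ⟨K₂, hK₂⟩ : ∃ K₂ : ℝ, K₂ = (3 * 5 ^ (d + 1)) * (κD * B₀ * ((ℓ : ℝ) + 1) ^ 4 * B6.c1 d' δ₀ (bb - ρ)) := ⟨_, rfl⟩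
  obtain ⟨K₃, hK₃⟩ : ∃ K₃ : ℝ, K₃ = (3 * 5 ^ (d + 1)) * ((2 * sLipT d ℓ * (αc * δ₀)⁻¹) * ((M₂ * ∑ j, ‖b j‖) ^ 2 * κG) * B₀ * ((ℓ : ℝ) + 1) ^ 4 *
      B6.c1 d' δ₀ (bb - ρ)) := ⟨_, rfl⟩
  obtain ⟨K₄, hK₄⟩ : ∃ K₄ : ℝ, K₄ = (3 * 5 ^ (d + 1)) * κE := ⟨_, rfl⟩
  have hK₄0 : 0 ≤ K₄ := by rw [hK₄]; exact mul_nonneg hN0 hκE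
  have hK₁0 : 0 ≤ K₁ := by rw [hK₁]; exact mul_nonneg hN0 (mul_nonneg (mul_nonneg (mul_nonneg hP0 hB₀) hL40) hcb0)
  have hK₂0 : 0 ≤ K₂ := by rw [hK₂]; exact mul_nonneg hN0 (mul_nonneg (mul_nonneg (mul_nonneg hκD hB₀) hL40) hcb0)
  have ha₁ : 0 < asep * δ₀ / (2 * ((ℓ : ℝ) + 1) ^ 2) := by positivity
  have ha₂ : 0 < 2 * δ₀ / (2 * ((ℓ : ℝ) + 1) ^ 2) := by positivity
  have ha₄ : 0 < aX * δ₀ / (2 * ((ℓ : ℝ) + 1) ^ 2) := by positivity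
  have hNB : 0 ≤ (3 * 5 ^ (d + 1)) * B₀ * B6.c1 d' (ρ * δ₀) α' := mul_nonneg (mul_nonneg hN0 hB₀) hc0
  refine ⟨max ML (max 1 (max (8 * K₁ * B6.c1 d' (ρ * δ₀) α' / (asep * δ₀ / (2 * ((ℓ : ℝ) + 1) ^ 2)))
      (max (8 * K₂ * B6.c1 d' (ρ * δ₀) α' / (2 * δ₀ / (2 * ((ℓ : ℝ) + 1) ^ 2))) (max (8 * K₃ * B6.c1 d' (ρ * δ₀) α')
      (8 * K₄ * B6.c1 d' (ρ * δ₀) α' / (aX * δ₀ / (2 * ((ℓ : ℝ) + 1) ^ 2))))))),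
    2 * ((3 * 5 ^ (d + 1)) * B₀ * B6.c1 d' (ρ * δ₀) α'), mul_nonneg zero_le_two hNB, fun i hM => ?_⟩
  intro parS Gp U ιB Oc hι hunit hpar Cl E hdef hC hGG hGGc hD hEd
  have hML : ML ≤ (geo9K i).M := (le_max_left _ _).trans hM
  have hM1 : (1 : ℝ) ≤ (geo9K i).M := ((le_max_left _ _).trans (le_max_right _ _)).trans hM
  have hM0 : 0 < (geo9K i).M := lt_of_lt_of_le one_pos hM1
  have hrest := (le_max_right _ _).trans ((le_max_right _ _).trans hM)
  have hT₁ : 8 * K₁ * B6.c1 d' (ρ * δ₀) α' / (asep * δ₀ / (2 * ((ℓ : ℝ) + 1) ^ 2)) ≤ (geo9K i).M := (le_max_left _ _).trans hrest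
  have hT₂ : 8 * K₂ * B6.c1 d' (ρ * δ₀) α' / (2 * δ₀ / (2 * ((ℓ : ℝ) + 1) ^ 2)) ≤ (geo9K i).M :=
    ((le_max_left _ _).trans (le_max_right _ _)).trans hrest
  have hT₃ : 8 * K₃ * B6.c1 d' (ρ * δ₀) α' ≤ (geo9K i).M :=
    (((le_max_left _ _).trans (le_max_right _ _)).trans (le_max_right _ _)).trans hrest
  have hT₄ : 8 * K₄ * B6.c1 d' (ρ * δ₀) α' / (aX * δ₀ / (2 * ((ℓ : ℝ) + 1) ^ 2)) ≤ (geo9K i).M :=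
    (((le_max_right _ _).trans (le_max_right _ _)).trans (le_max_right _ _)).trans hrest
  have hD₁ : asep * δ₀ * DsepT i = asep * δ₀ / (2 * ((ℓ : ℝ) + 1) ^ 2) * (geo9K i).M := by rw [DsepT_eq_div]; ring
  have hD₂ : 2 * δ₀ * DsepT i = 2 * δ₀ / (2 * ((ℓ : ℝ) + 1) ^ 2) * (geo9K i).M := by rw [DsepT_eq_div]; ring
  have hD₄ : aX * δ₀ * DsepT i = aX * δ₀ / (2 * ((ℓ : ℝ) + 1) ^ 2) * (geo9K i).M := by rw [DsepT_eq_div]; ring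
  -- the located smallness of §2, discharged
  have hS : ((3 * 5 ^ (d + 1)) * (((M₂ * ∑ j, ‖b j‖) ^ 2 * κG) * B₀ * ((ℓ : ℝ) + 1) ^ 4 * B6.c1 d' δ₀ (bb - ρ) * Real.exp (-(asep * δ₀ * DsepT i))) +
      (3 * 5 ^ (d + 1)) * (κD * Real.exp (-(2 * δ₀ * DsepT i)) * B₀ * ((ℓ : ℝ) + 1) ^ 4 * B6.c1 d' δ₀ (bb - ρ)) +
      (3 * 5 ^ (d + 1)) * ((lipT i * (αc * δ₀)⁻¹) * ((M₂ * ∑ j, ‖b j‖) ^ 2 * κG) * B₀ * ((ℓ : ℝ) + 1) ^ 4 * B6.c1 d' δ₀ (bb - ρ)) +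
      (3 * 5 ^ (d + 1)) * (κE * Real.exp (-(aX * δ₀ * DsepT i)))) *
      B6.c1 d' (ρ * δ₀) α' ≤ 2⁻¹ :=
    smallness_shape4 hK₁0 hK₂0 hK₄0 hc0 ha₁ ha₂ ha₄ hM0 hD₁ hD₂ hD₄ (lipT_eq i) hK₁ hK₂ hK₃ hK₄ hT₁ hT₂ hT₃ hT₄
  have h := h12 i hML parS Gp U ιB Oc hι hunit hpar Cl E hκG hκD hκE hB₀ hasep.le hρE hαc hsplit₁ hsplit₂ hsplit₃ rfl rfl rfl rfl
    (lt_of_le_of_lt hS (by norm_num)) hdef hC hGG hGGc hD hEd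
  -- `(1 − (θ₁+θ₂+θ₃+θ₄)c₁)⁻¹ ≦ 2`
  refine hasMajorant_mono (g := toB6 (geo9K i) (Rr i) (Hp i)) _ h fun a a' => ?_
  set S := ((3 * 5 ^ (d + 1)) * (((M₂ * ∑ j, ‖b j‖) ^ 2 * κG) * B₀ * ((ℓ : ℝ) + 1) ^ 4 * B6.c1 d' δ₀ (bb - ρ) * Real.exp (-(asep * δ₀ * DsepT i))) +
      (3 * 5 ^ (d + 1)) * (κD * Real.exp (-(2 * δ₀ * DsepT i)) * B₀ * ((ℓ : ℝ) + 1) ^ 4 * B6.c1 d' δ₀ (bb - ρ)) +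
      (3 * 5 ^ (d + 1)) * ((lipT i * (αc * δ₀)⁻¹) * ((M₂ * ∑ j, ‖b j‖) ^ 2 * κG) * B₀ * ((ℓ : ℝ) + 1) ^ 4 * B6.c1 d' δ₀ (bb - ρ)) +
      (3 * 5 ^ (d + 1)) * (κE * Real.exp (-(aX * δ₀ * DsepT i)))) *
      B6.c1 d' (ρ * δ₀) α' with hSdef
  have hX : (1 - S)⁻¹ ≤ 2 := by
    have h2 : (2 : ℝ)⁻¹ ≤ 1 - S := by linarith [hS]
    calc (1 - S)⁻¹ ≤ ((2 : ℝ)⁻¹)⁻¹ := inv_anti₀ (by norm_num) h2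
      _ = 2 := inv_inv 2
  have hW : 0 ≤ ((geo9K i).len a ^ 4)⁻¹ * Real.exp (-((1 - α') * (ρ * δ₀) * (geo9K i).dist a a')) :=
    mul_nonneg (inv_nonneg.mpr (pow_nonneg (B6KLevelCensusIndexV1.len_pos i a).le 4)) (Real.exp_nonneg _)
  calc (3 * 5 ^ (d + 1)) * B₀ * B6.c1 d' (ρ * δ₀) α' * (1 - S)⁻¹ * ((geo9K i).len a ^ 4)⁻¹ *
        Real.exp (-((1 - α') * (ρ * δ₀) * (geo9K i).dist a a'))
      = ((3 * 5 ^ (d + 1)) * B₀ * B6.c1 d' (ρ * δ₀) α' * (1 - S)⁻¹) *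
          (((geo9K i).len a ^ 4)⁻¹ * Real.exp (-((1 - α') * (ρ * δ₀) * (geo9K i).dist a a'))) := by ring
    _ ≤ ((3 * 5 ^ (d + 1)) * B₀ * B6.c1 d' (ρ * δ₀) α' * 2) *
          (((geo9K i).len a ^ 4)⁻¹ * Real.exp (-((1 - α') * (ρ * δ₀) * (geo9K i).dist a a'))) :=
        mul_le_mul_of_nonneg_right (mul_le_mul_of_nonneg_left hX hNB) hW
    _ = 2 * ((3 * 5 ^ (d + 1)) * B₀ * B6.c1 d' (ρ * δ₀) α') * ((geo9K i).len a ^ 4)⁻¹ *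
          Real.exp (-((1 - α') * (ρ * δ₀) * (geo9K i).dist a a')) := by ring

end Literature.MathematicalPhysics.QuantumFieldTheory.Balaban1983to89.B9Thm39CinvAtCoverMemberDefect

end
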